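import Summits.HubbardSuperconductivity.HubbardLadder.XInvariance

/-!
# PairOpTable — pair lists versus weight tables: the scaling identities of [C](d1) (generic part)

HONEST FRAMING: ladder R1–R4 with certified numbers; no claim on H/H₀.  Cell pub-hubbard, lane r2 (g43).  The kernel certificates
([C](c)) speak about `pairOp P` for an integer PAIR LIST `P` (one orientation per pair); the symmetry bookkeeping ([C](b0″)) and the
torus window ([A]) speak about `weightedPairOp n w = Σ_{i,j} w i j • 𝐒_i·𝐒_j` for a weight TABLE.  This file relates them:
`pairOp P = weightedPairOp 1 (tableOfPairList P)` (§1), tables are additive / homogeneous / transpose-invariant under `weightedPairOp`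
(§2, via `𝐒_i·𝐒_j = 𝐒_j·𝐒_i`), so a SYMMETRISED table gives twice the operator (§3).  All [folklore].
-/

namespace Summit.HubbardSuperconductivity.HubbardLadder.ClusterCut

open Matrix Literature.MathematicalPhysics.QuantumLattice

variable {N : ℕ}

/-! ## §1 The weight table of a pair list -/

/-- Total weight a pair list carries at the ORDERED pair `(i, j)`. [folklore] -/
def tableOfPairList : PairList N → Fin N → Fin N → ℤ
  | [], _, _ => 0
  | p :: P, i, j => (if p.1 = i then (if p.2.1 = j then p.2.2 else 0) else 0) + tableOfPairList P i j

/-- One step of the table: the head pair contributes `w • 𝐒_i·𝐒_j`. [folklore] -/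
theorem weightedPairOp_table_cons (n : ℕ) (p : Fin N × Fin N × ℤ) (P : PairList N) :
    weightedPairOp n (fun i j => ((tableOfPairList (p :: P) i j : ℤ) : ℂ)) =
      ((p.2.2 : ℤ) : ℂ) • spinDot n p.1 p.2.1 + weightedPairOp n (fun i j => ((tableOfPairList P i j : ℤ) : ℂ)) := by
  simp only [weightedPairOp, tableOfPairList, Int.cast_add, Int.cast_ite, Int.cast_zero, add_smul, Finset.sum_add_distrib, ite_smul,
    zero_smul]
  congr 1
  rw [Finset.sum_eq_single p.1 (fun b _ hb => by simp only [if_neg (Ne.symm hb), Finset.sum_const_zero])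
    (fun h => absurd (Finset.mem_univ _) h)]
  simp only [if_true, Finset.sum_ite_eq, Finset.mem_univ]

/-- **Pair list = its table**: `X_P = Σ_{i,j} (tableOfPairList P i j) • 𝐒_i·𝐒_j` (spin ½). [folklore] -/
theorem pairOp_eq_weightedPairOp (P : PairList N) :
    pairOp P = weightedPairOp 1 (fun i j => ((tableOfPairList P i j : ℤ) : ℂ)) := by
  induction P with
  | nil => simp [pairOp, weightedPairOp, tableOfPairList]
  | cons p P ih =>
    rw [weightedPairOp_table_cons, ← ih]
    simp [pairOp]

/-! ## §2 Linearity and transpose-invariance of `weightedPairOp` in the table -/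

/-- Additivity in the table. [folklore] -/
theorem weightedPairOp_add (n : ℕ) (w w' : Fin N → Fin N → ℂ) :
    weightedPairOp n (fun i j => w i j + w' i j) = weightedPairOp n w + weightedPairOp n w' := by
  simp only [weightedPairOp, add_smul, Finset.sum_add_distrib]

/-- Homogeneity in the table. [folklore] -/
theorem weightedPairOp_const_mul (n : ℕ) (c : ℂ) (w : Fin N → Fin N → ℂ) :
    weightedPairOp n (fun i j => c * w i j) = c • weightedPairOp n w := by
  simp only [weightedPairOp, mul_smul, Finset.smul_sum]

/-- Transpose-invariance (`𝐒_i·𝐒_j = 𝐒_j·𝐒_i`). [folklore] -/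
theorem weightedPairOp_transpose (n : ℕ) (w : Fin N → Fin N → ℂ) :
    weightedPairOp n (fun i j => w j i) = weightedPairOp n w := by
  unfold weightedPairOp
  rw [Finset.sum_comm]
  refine Finset.sum_congr rfl fun i _ => Finset.sum_congr rfl fun j _ => ?_
  rw [spinDot_comm]

/-! ## §3 Symmetrised tables -/

/-- **Symmetrisation doubles**: `Σ (w i j + w j i) • 𝐒_i·𝐒_j = 2 • Σ w i j • 𝐒_i·𝐒_j`. [folklore] -/
theorem weightedPairOp_symmetrise (n : ℕ) (w : Fin N → Fin N → ℂ) :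
    weightedPairOp n (fun i j => w i j + w j i) = (2 : ℂ) • weightedPairOp n w := by
  rw [weightedPairOp_add, weightedPairOp_transpose, two_smul]

/-- **Pair list versus symmetrised integer table**: if `W i j = T i j + T j i` entrywise for `T = tableOfPairList P`, then
`Σ W i j • 𝐒_i·𝐒_j = 2 • X_P`.  (For it4: `W = wSymIt4`, `P` = the cut's integer pair list, the hypothesis by `decide`.) [folklore] -/
theorem weightedPairOp_of_symmetrised (P : PairList N) (W : Fin N → Fin N → ℤ)
    (hW : ∀ i j, W i j = tableOfPairList P i j + tableOfPairList P j i) :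
    weightedPairOp 1 (fun i j => ((W i j : ℤ) : ℂ)) = (2 : ℂ) • pairOp P := by
  rw [pairOp_eq_weightedPairOp, ← weightedPairOp_symmetrise]
  congr 1
  funext i j
  rw [hW, Int.cast_add]

/-- **Real table versus integer table**: `Σ ((W i j : ℝ) / D : ℂ) • 𝐒_i·𝐒_j = (1/D) • Σ (W i j : ℂ) • 𝐒_i·𝐒_j` — the form in which the torus
window (`clusterCutRow_window`, real weights) meets the kernel side (integer weights). [folklore] -/
theorem weightedPairOp_realDiv (n : ℕ) (W : Fin N → Fin N → ℤ) (D : ℝ) :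
    (∑ i, ∑ j, ((((W i j : ℤ) : ℝ) / D : ℝ) : ℂ) • spinDot n i j : Op (Fin N) (n + 1)) =
      ((1 / D : ℝ) : ℂ) • weightedPairOp n (fun i j => ((W i j : ℤ) : ℂ)) := by
  rw [← weightedPairOp_const_mul]
  unfold weightedPairOp
  refine Finset.sum_congr rfl fun i _ => Finset.sum_congr rfl fun j _ => ?_
  congr 1
  push_cast
  ring

end Summit.HubbardSuperconductivity.HubbardLadder.ClusterCut
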